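import Summits.NavierStokesRegularity.NavierStokesRegularity.Theorems.ExtremiserTransienceNearExtremalTransienceExtremiserLiouvilleNoAnalyticExtremalResidue
import HarnessLib

/-!
# Crux `ExtremiserTransience.NearExtremalTransience` (stmt-NavierStokesRegularity-21883), line `extremiser_liouville`,
# stub K1b — STRICT SUB-EXTREMALITY OF ANALYTIC FIELDS WITH A FAR-FIELD GAP (card remark R0, now unconditional)

`--supports stmt-NavierStokesRegularity-21883` (helper).  Author: prover seat `ns-el-k1b` (g2).

With the extended sharp inequality a theorem (`ExtremiserLiouville.extendedSharp`, from the density leaf), g0's port of the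
KKT/plateau argument (`ext_not_extremal_of_analytic_of_farFieldGap`) gives STRICT sub-extremality for every real-analytic field
of the extended class whose speed stays a definite amount below its bound outside some ball — in particular for every analytic
field tending to `0` at infinity (the shape of an actual slice `u(t)` of a classical rapidly-decaying solution):

* `abs_stretching_lt_of_analytic_of_farFieldGap` — `|S(v)| < κ⋆·M·‖ω‖₂‖∇ω‖₂`;
* `abs_stretching_lt_of_analytic_of_tendsto_zero` — the same for `v → 0` at infinity.

So K1b can only fail through fields whose sup is approached at infinity (`…NoAnalyticExtremalResidue`: the drift extremisers).

WHAT THIS IS NOT: not K1b; a pointwise-in-time strictness remark, NOT the integrated log-mean gap NET needs; the crux NET, rung N0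
and NS regularity stay OPEN — nothing here proves NS regularity. [folklore]
-/

noncomputable section

open Set Filter Topology MeasureTheory Metric
open scoped InnerProductSpace RealInnerProductSpace ENNReal NNReal
open Literature.Analysis.FluidPDE

namespace Summit.NavierStokesRegularity.NavierStokesRegularity.Theorems

-- the problem directory repeats the summit name (`NavierStokesRegularity/NavierStokesRegularity`)
set_option linter.dupNamespace false

namespace ExtremiserLiouville

variable {v : EuclideanSpace ℝ (Fin 3) → EuclideanSpace ℝ (Fin 3)}

/-- **Strict sub-extremality under a far-field gap.**  A real-analytic field of the extended class with
`M‖ω‖₂‖∇ω‖₂ > 0` and `‖v‖ ≤ M' < M` outside some ball satisfies `|S(v)| < κ⋆·M·‖ω‖₂‖∇ω‖₂`. [folklore] -/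
theorem abs_stretching_lt_of_analytic_of_farFieldGap (hv : ContDiff ℝ (⊤ : ℕ∞) v) (han : AnalyticOnNhd ℝ v univ)
    (hdiv : VectorCalculus.IsDivFree v) {M B M' R : ℝ} (hM : ∀ x, ‖v x‖ ≤ M) (hB : ∀ x, ‖fderiv ℝ v x‖ ≤ B)
    (h1 : ∫⁻ x, ‖iteratedFDeriv ℝ 1 v x‖ₑ ^ 2 < ⊤) (h2 : ∫⁻ x, ‖iteratedFDeriv ℝ 2 v x‖ₑ ^ 2 < ⊤)
    (hpos : 0 < M * Real.sqrt (∫ x, ‖curl v x‖ ^ 2) * Real.sqrt (∫ x, frobeniusNormSq (fderiv ℝ (curl v) x)))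
    (hM' : M' < M) (hR : ∀ x : EuclideanSpace ℝ (Fin 3), R ≤ ‖x‖ → ‖v x‖ ≤ M') :
    |∫ x, ⟪curl v x, fderiv ℝ v x (curl v x)⟫| <
      (sInf {κ : ℝ | (∀ (v : EuclideanSpace ℝ (Fin 3) → EuclideanSpace ℝ (Fin 3)) (M B : ℝ), ContDiff ℝ (⊤ : ℕ∞) v → Literature.Analysis.FluidPDE.VectorCalculus.IsDivFree v → (∀ x, ‖v x‖ ≤ M) → (∀ x, ‖fderiv ℝ v x‖ ≤ B) → (∫⁻ x, ‖iteratedFDeriv ℝ 0 v x‖ₑ ^ 2 < ⊤) → (∫⁻ x, ‖iteratedFDeriv ℝ 1 v x‖ₑ ^ 2 < ⊤) → (∫⁻ x, ‖iteratedFDeriv ℝ 2 v x‖ₑ ^ 2 < ⊤) → |∫ x, ⟪Literature.Analysis.FluidPDE.curl v x, fderiv ℝ v x (Literature.Analysis.FluidPDE.curl v x)⟫_ℝ| ≤ κ * M * Real.sqrt (∫ x, ‖Literature.Analysis.FluidPDE.curl v x‖ ^ 2) * Real.sqrt (∫ x, Literature.Analysis.FluidPDE.frobeniusNormSq (fderiv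 ℝ (Literature.Analysis.FluidPDE.curl v) x)))}) * M * Real.sqrt (∫ x, ‖curl v x‖ ^ 2) * Real.sqrt (∫ x, frobeniusNormSq (fderiv ℝ (curl v) x)) :=
  lt_of_le_of_ne (extendedSharp v M B hv hdiv hM hB h1 h2)
    (ext_not_extremal_of_analytic_of_farFieldGap extendedSharp hv han hdiv hM hB h1 h2 hpos hM' hR)

/-- **Strict sub-extremality for analytic fields vanishing at infinity** (an actual slice of the crux's flows is real-analytic
in space and tends to `0`): `|S(v)| < κ⋆·M·‖ω‖₂‖∇ω‖₂` whenever `M‖ω‖₂‖∇ω‖₂ > 0`. [folklore] -/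
theorem abs_stretching_lt_of_analytic_of_tendsto_zero (hv : ContDiff ℝ (⊤ : ℕ∞) v) (han : AnalyticOnNhd ℝ v univ)
    (hdiv : VectorCalculus.IsDivFree v) {M B : ℝ} (hM : ∀ x, ‖v x‖ ≤ M) (hB : ∀ x, ‖fderiv ℝ v x‖ ≤ B)
    (h1 : ∫⁻ x, ‖iteratedFDeriv ℝ 1 v x‖ₑ ^ 2 < ⊤) (h2 : ∫⁻ x, ‖iteratedFDeriv ℝ 2 v x‖ₑ ^ 2 < ⊤)
    (hpos : 0 < M * Real.sqrt (∫ x, ‖curl v x‖ ^ 2) * Real.sqrt (∫ x, frobeniusNormSq (fderiv ℝ (curl v) x)))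
    (hdec : Tendsto v (cocompact (EuclideanSpace ℝ (Fin 3))) (𝓝 0)) :
    |∫ x, ⟪curl v x, fderiv ℝ v x (curl v x)⟫| <
      (sInf {κ : ℝ | (∀ (v : EuclideanSpace ℝ (Fin 3) → EuclideanSpace ℝ (Fin 3)) (M B : ℝ), ContDiff ℝ (⊤ : ℕ∞) v → Literature.Analysis.FluidPDE.VectorCalculus.IsDivFree v → (∀ x, ‖v x‖ ≤ M) → (∀ x, ‖fderiv ℝ v x‖ ≤ B) → (∫⁻ x, ‖iteratedFDeriv ℝ 0 v x‖ₑ ^ 2 < ⊤) → (∫⁻ x, ‖iteratedFDeriv ℝ 1 v x‖ₑ ^ 2 < ⊤) → (∫⁻ x, ‖iteratedFDeriv ℝ 2 v x‖ₑ ^ 2 < ⊤) → |∫ x, ⟪Literature.Analysis.FluidPDE.curl v x, fderiv ℝ v x (Literature.Analysis.FluidPDE.curl v x)⟫_ℝ| ≤ κ * M * Real.sqrt (∫ x, ‖Literature.Analysis.FluidPDE.curl v x‖ ^ 2) * Real.sqrt (∫ x, Literature.Analysis.FluidPDE.frobeniusNormSq (fderiv ℝ (Literature.Analysis.FluidPDE.curl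 v) x)))}) * M * Real.sqrt (∫ x, ‖curl v x‖ ^ 2) * Real.sqrt (∫ x, frobeniusNormSq (fderiv ℝ (curl v) x)) := by
  -- `M > 0` (else the product in `hpos` vanishes)
  have hM0 : 0 < M := by
    rcases lt_or_ge 0 M with h | h
    · exact h
    · exfalso
      have hZ := Real.sqrt_nonneg (∫ x, ‖curl v x‖ ^ 2)
      have hP := Real.sqrt_nonneg (∫ x, frobeniusNormSq (fderiv ℝ (curl v) x))
      have : M * Real.sqrt (∫ x, ‖curl v x‖ ^ 2) * Real.sqrt (∫ x, frobeniusNormSq (fderiv ℝ (curl v) x)) ≤ 0 :=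
        mul_nonpos_of_nonpos_of_nonneg (mul_nonpos_of_nonpos_of_nonneg h hZ) hP
      exact absurd hpos (not_lt.2 this)
  -- far-field gap `‖v‖ ≤ M/2` beyond some radius
  have hev : ∀ᶠ x in cocompact (EuclideanSpace ℝ (Fin 3)), ‖v x‖ ≤ M / 2 :=
    (tendsto_zero_iff_norm_tendsto_zero.1 hdec).eventually (Iic_mem_nhds (by positivity : (0:ℝ) < M / 2))
  obtain ⟨K, hK, hKsub⟩ := mem_cocompact.1 hev
  obtain ⟨ρ, hρ⟩ := hK.isBounded.subset_closedBall (0 : EuclideanSpace ℝ (Fin 3))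
  have hR : ∀ x : EuclideanSpace ℝ (Fin 3), ρ + 1 ≤ ‖x‖ → ‖v x‖ ≤ M / 2 := by
    intro x hx
    refine hKsub fun hxK => ?_
    have := mem_closedBall_zero_iff.1 (hρ hxK)
    linarith
  exact abs_stretching_lt_of_analytic_of_farFieldGap hv han hdiv hM hB h1 h2 hpos (by linarith : M / 2 < M) hR

end ExtremiserLiouville

end Summit.NavierStokesRegularity.NavierStokesRegularity.Theorems

end
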